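import Summits.BirchSwinnertonDyer.BirchSwinnertonDyer.Theorems.SignedLowerHalvesSmallImageLowerHalfBothSignsValveReverse
import HarnessLib

/-!
# Route `SignedLowerHalves`, crux L `SmallImageLowerHalfBothSigns` (item stmt-BirchSwinnertonDyer-23599), line `rtt_w3` — crux idea `valve`:
# the μ-FLOOR TRANSFER partner curve → `W` at a supersingular prime (tier T1: CM ELLIPTIC-CURVE partner)

Width seat `bsd-line-slh-p3-w3` g15 under LEAD `cruxlead-stmt-BirchSwinnertonDyer-23599` (cell `bsd-ssimc`); ROUTE-INDEPENDENT helper (`--supports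
stmt-BirchSwinnertonDyer-23599`); THEOREMS ONLY (no definition, no named fact, no `sorry`); closes nothing; BSD / crux L / crux M are proved for NO
curve by this. Memo `Lines/rtt_w3-MEMO-w3-g13.md` recorded wall W6 «the one-sign μ-floor is NOT transferable from a partner (canonical-period
ambiguity)». In ORBIT-SUM currency it IS transferable when the partner is an elliptic curve `A` (tier T1 of the line): the valve
(`…ValveFloor.muOneSign_body_of_orbitUnitCert`, B2 discharged) needs brick B1 for the depleted partner newform `g₁` in SOME integral normalisation,
and the `Ω⁺_g`-normalisation of `A`'s newform `g` is one: it is integral at every cusp (`A[p]` irreducible, tree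
`norm_ratPlusSymbol_le_one_of_irreducible`) and a unit ω⁰-orbit sum of `g` survives depletion (`…ValveReverse.exists_norm_depletedOrbitSum_eq_one`
applied to `A`).

* ★ `muOneSign_body_of_partner_teichOrbitSum` — `W, A / ℚ` elliptic, globally minimal, both good supersingular at the odd prime `p` (`a_p = 0`),
  newforms `f`, `g`; a pair `(f₁, g₁)` on `Γ₀(M)` with the OUTPUT clauses of Vatsal's congruence and the Euler-factor depletion identities of `f₁`
  (from `f`) and `g₁` (from `g`); if SOME Teichmüller ω⁰-orbit sum of `g` at a level `≥ 1` is a `p`-adic unit, then the floor stub body holds for `f`: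
  `∃ ε L, IsSignedPAdicLFunction f p ε L ∧ HasUnitContent L`.

References: [Vatsal1999] Thm. (1.13); [GreenbergVatsal2000] §1 (8)–(9), §3 Rem. (3.4); [MazurTateTeitelbaum1986Invent] §I.10 (10.1); [Pollack2003] Conj. 6.3.
-/

set_option autoImplicit false
-- D-0017: single-problem summit, the namespace repeats the problem name by design.
set_option linter.dupNamespace false
noncomputable section

open scoped Classical MatrixGroups ModularForm
open Polynomial CongruenceSubgroup Literature.NumberTheory.EllipticCurves Literature.NumberTheory.EllipticCurves.ModularForms
  Literature.NumberTheory.EllipticCurves.Kobayashi2003 Literature.NumberTheory.EllipticCurves.GreenbergVatsal2000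
  Literature.NumberTheory.EllipticCurves.Rank1Residual Literature.NumberTheory.GaloisRepresentations
  Summit.BirchSwinnertonDyer.BirchSwinnertonDyer.Theorems.SmallImageHeckePrimeMu

namespace Summit.BirchSwinnertonDyer.BirchSwinnertonDyer.Theorems.SmallImageValve

variable {p : ℕ} [hp : Fact p.Prime] {N N' M₀ : ℕ} [NeZero N] [NeZero N']

/-- ★ **μ-floor transfer, partner curve → `W` (tier T1).** `W, A / ℚ` elliptic and globally minimal, `p` odd, both of good supersingular reduction
(`a_p(W) = a_p(A) = 0`), `f` a newform of `W`, `g` a newform of `A`; a pair `(f₁, g₁)` on `Γ₀(M₀)` with the OUTPUT clauses of Vatsal's canonical-period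
congruence along `ι` (`hVf hVg hVc hVu`); the depletion identities of `f₁` from `f` (`hdep`, family `ℓ, P`) and of `g₁` from `g` (`hdep'`, family
`ℓ', P'`), integers `> 1` prime to `p`, integer polynomials with constant term `1`. If some ω⁰-orbit sum `S_g(p, m, u)` (`m ≥ 1`, `u` a unit) of the
PARTNER is a `p`-adic unit, then the floor stub body holds for `f`: `∃ ε L, IsSignedPAdicLFunction f p ε L ∧ HasUnitContent L`. Proof: B1 for `g₁`
with `c = ι⁻¹(Ωg/Ω⁺_g)` (the `Ω⁺_g`-normalised depleted symbol of `g`: integral at every cusp since `A[p]` is irreducible, with a unit orbit sum by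
`exists_norm_depletedOrbitSum_eq_one` for `A`), then `muOneSign_body_of_orbitUnitCert`. [cite: Vatsal1999, Thm. (1.13)]
[cite: GreenbergVatsal2000, §3 Remark (3.4)] [cite: MazurTateTeitelbaum1986Invent, §I.10 (10.1)] -/
theorem muOneSign_body_of_partner_teichOrbitSum {W A : WeierstrassCurve ℚ} [W.IsElliptic] [W.IsGloballyMinimal] [A.IsElliptic]
    [A.IsGloballyMinimal] {f : CuspForm (Gamma0 N) 2} {g : CuspForm (Gamma0 N') 2} (hp2 : p ≠ 2)
    (hf : IsNewformOf W f) (hgood : W.HasGoodReductionAtPrime p) (hap : W.frobeniusTrace p = 0)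
    (hg : IsNewformOf A g) (hgoodA : A.HasGoodReductionAtPrime p) (hapA : A.frobeniusTrace p = 0)
    (ι : PadicAlgCl p ≃+* ℂ) (f₁ g₁ : CuspForm (Gamma0 M₀) 2) {Ωf Ωg : ℂ} (hΩf : Ωf ≠ 0) (hΩg : Ωg ≠ 0)
    (hVf : ∀ x : ℚ, Valued.v (ι.symm (plusSymbol f₁ x / Ωf)) ≤ 1)
    (hVg : ∀ x : ℚ, Valued.v (ι.symm (plusSymbol g₁ x / Ωg)) ≤ 1)
    (hVc : ∀ x : ℚ, Valued.v (ι.symm (plusSymbol f₁ x / Ωf - plusSymbol g₁ x / Ωg)) < 1)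
    (hVu : ∃ x : ℚ, Valued.v (ι.symm (plusSymbol f₁ x / Ωf)) = 1)
    {κ : Type*} [Fintype κ] [DecidableEq κ] (ℓ : κ → ℕ) (hℓ : ∀ i, 1 < ℓ i ∧ ¬ p ∣ ℓ i) (P : κ → ℤ[X]) (hP0 : ∀ i, (P i).coeff 0 = 1)
    (hdep : ∀ x : ℚ, plusSymbol f₁ x = ∑ k ∈ Fintype.piFinset (fun _ : κ ↦ Finset.range 3),
      (((∏ i, ((P i).coeff (k i) : ℚ) * ((ℓ i : ℚ) ^ (k i))⁻¹ : ℚ) : ℚ) : ℂ) * plusSymbol f (((∏ i, ℓ i ^ (k i) : ℕ) : ℚ) * x))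
    {κ' : Type*} [Fintype κ'] [DecidableEq κ'] (ℓ' : κ' → ℕ) (hℓ' : ∀ i, 1 < ℓ' i ∧ ¬ p ∣ ℓ' i) (P' : κ' → ℤ[X])
    (hP0' : ∀ i, (P' i).coeff 0 = 1)
    (hdep' : ∀ x : ℚ, plusSymbol g₁ x = ∑ k ∈ Fintype.piFinset (fun _ : κ' ↦ Finset.range 3),
      (((∏ i, ((P' i).coeff (k i) : ℚ) * ((ℓ' i : ℚ) ^ (k i))⁻¹ : ℚ) : ℚ) : ℂ) * plusSymbol g (((∏ i, ℓ' i ^ (k i) : ℕ) : ℚ) * x))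
    {m : ℕ} (hm : 1 ≤ m) (h : ∃ u : (ZMod (p ^ m))ˣ, ‖((teichOrbitSum g p m (u : ZMod (p ^ m)) : ℚ) : ℚ_[p])‖ = 1) :
    ∃ (ε : ℤˣ) (L : IwasawaAlgebra p), IsSignedPAdicLFunction f p ε L ∧ HasUnitContent L := by
  have hp' : p.Prime := Fact.out
  have hg0 : IsNewform0 g := hg.1
  have hQg : coeffField g = ⊥ := hg.coeffField_eq_bot
  have hΩgpos : 0 < plusPeriod g := IsNewform0.plusPeriod_pos_holds hg0 hQg
  have hΩg' : (plusPeriod g : ℂ) ≠ 0 := by exact_mod_cast hΩgpos.ne'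
  have hirrA : A.HasIrreducibleModPGaloisRep p :=
    hasIrreducibleModPGaloisRep_of_dvd_frobeniusTrace A p hp2
      (A.not_dvd_minimalDiscriminantInt_of_hasGoodReductionAtPrime' p hgoodA) (by rw [hapA]; exact dvd_zero _)
  have nrc : ∀ q : ℚ, ‖(q : PadicAlgCl p)‖ = ‖(q : ℚ_[p])‖ := fun q ↦ by
    rw [← map_ratCast (algebraMap ℚ_[p] (PadicAlgCl p)) q]; exact PadicAlgCl.norm_extends p _
  -- the `Ω⁺_g`-normalised depleted symbol `D_g` of `g` and `c = ι⁻¹(Ωg/Ω⁺_g)`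
  have hdepΩ : ∀ x : ℚ, plusSymbol g₁ x =
      ((∑ k ∈ Fintype.piFinset (fun _ : κ' ↦ Finset.range 3), (∏ i, ((P' i).coeff (k i) : ℚ) * ((ℓ' i : ℚ) ^ (k i))⁻¹) *
        ratPlusSymbol g (((∏ i, ℓ' i ^ (k i) : ℕ) : ℚ) * x) : ℚ) : ℂ) * (plusPeriod g : ℂ) := by
    intro x
    rw [hdep' x, Rat.cast_sum, Finset.sum_mul]
    refine Finset.sum_congr rfl fun k _ ↦ ?_
    rw [Rat.cast_mul, mul_assoc, ratCast_ratPlusSymbol_mul_plusPeriod g hg0 hQg (((∏ i, ℓ' i ^ (k i) : ℕ) : ℚ) * x)]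
  have hcv : ∀ x : ℚ, ι.symm (Ωg / (plusPeriod g : ℂ)) * ι.symm (plusSymbol g₁ x / Ωg) =
      ((∑ k ∈ Fintype.piFinset (fun _ : κ' ↦ Finset.range 3), (∏ i, ((P' i).coeff (k i) : ℚ) * ((ℓ' i : ℚ) ^ (k i))⁻¹) *
        ratPlusSymbol g (((∏ i, ℓ' i ^ (k i) : ℕ) : ℚ) * x) : ℚ) : PadicAlgCl p) := by
    intro x
    rw [← map_mul, ← map_ratCast ι.symm]
    congr 1
    rw [hdepΩ x]
    set d : ℚ := ∑ k ∈ Fintype.piFinset (fun _ : κ' ↦ Finset.range 3), (∏ i, ((P' i).coeff (k i) : ℚ) * ((ℓ' i : ℚ) ^ (k i))⁻¹) *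
      ratPlusSymbol g (((∏ i, ℓ' i ^ (k i) : ℕ) : ℚ) * x)
    field_simp
  -- integrality of `D_g` at every cusp (`A[p]` irreducible)
  have hcoef : ∀ k : κ' → ℕ, ‖(((∏ i, ((P' i).coeff (k i) : ℚ) * ((ℓ' i : ℚ) ^ (k i))⁻¹ : ℚ) : ℚ) : ℚ_[p])‖ ≤ 1 := by
    intro k
    rw [Rat.cast_prod, norm_prod]
    refine Finset.prod_le_one (fun i _ ↦ norm_nonneg _) fun i _ ↦ ?_
    have hℓ1 : ‖((ℓ' i : ℕ) : ℚ_[p])‖ = 1 :=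
      Padic.norm_natCast_eq_one_iff.mpr ((Nat.Prime.coprime_iff_not_dvd hp').mpr (hℓ' i).2)
    rw [Rat.cast_mul, Rat.cast_inv, Rat.cast_pow, Rat.cast_natCast, Rat.cast_intCast, norm_mul, norm_inv, norm_pow, hℓ1, one_pow,
      inv_one, mul_one]
    exact Padic.norm_int_le_one _
  have hDint : ∀ x : ℚ, ‖((∑ k ∈ Fintype.piFinset (fun _ : κ' ↦ Finset.range 3), (∏ i, ((P' i).coeff (k i) : ℚ) * ((ℓ' i : ℚ) ^ (k i))⁻¹) *
        ratPlusSymbol g (((∏ i, ℓ' i ^ (k i) : ℕ) : ℚ) * x) : ℚ) : ℚ_[p])‖ ≤ 1 := by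
    intro x
    rw [Rat.cast_sum]
    refine IsUltrametricDist.norm_sum_le_of_forall_le_of_nonneg zero_le_one fun k _ ↦ ?_
    rw [Rat.cast_mul, norm_mul]
    exact mul_le_one₀ (hcoef k) (norm_nonneg _)
      (Summit.BirchSwinnertonDyer.Rank1Residual.Additive.norm_ratPlusSymbol_le_one_of_irreducible hp2 hg hirrA _)
  -- a unit DEPLETED orbit sum of `g` (valve reverse §2 for `A`)
  obtain ⟨n, hn, b, hunit⟩ := exists_norm_depletedOrbitSum_eq_one hp2 hg hgoodA hapA ℓ' hℓ' P' hP0' hm h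
  have hswap : (∑ t ∈ (Finset.univ : Finset (ZMod (p ^ n))).filter (fun t => t ^ (p - 1) = 1),
      ∑ k ∈ Fintype.piFinset (fun _ : κ' ↦ Finset.range 3), (∏ i, ((P' i).coeff (k i) : ℚ) * ((ℓ' i : ℚ) ^ (k i))⁻¹) *
        ratPlusSymbol g (((∏ i, ℓ' i ^ (k i) : ℕ) : ℚ) * ((((t * (b : ZMod (p ^ n))).val : ℕ) : ℚ) / (p : ℚ) ^ n)) : ℚ) =
      ∑ k ∈ Fintype.piFinset (fun _ : κ' ↦ Finset.range 3), (∏ i, ((P' i).coeff (k i) : ℚ) * ((ℓ' i : ℚ) ^ (k i))⁻¹) *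
        teichOrbitSum g p n (((∏ i, ℓ' i ^ (k i) : ℕ) : ZMod (p ^ n)) * (b : ZMod (p ^ n))) := by
    rw [Finset.sum_comm]
    refine Finset.sum_congr rfl fun k _ ↦ ?_
    rw [← Finset.mul_sum, sum_ratPlusSymbol_mul_eq_teichOrbitSum]
  rw [← hswap] at hunit
  -- brick B1 for `g₁` with `c = ι⁻¹(Ωg/Ω⁺_g)`, then the valve
  refine muOneSign_body_of_orbitUnitCert hp2 hf hgood hap ι f₁ g₁ hΩf hVf hVg hVc hVu ℓ hℓ P hP0 hdep
    ⟨ι.symm (Ωg / (plusPeriod g : ℂ)), fun x ↦ by rw [hcv, nrc]; exact hDint x, n, hn, b, ?_⟩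
  rw [Finset.sum_congr rfl fun t _ ↦ hcv _, ← Rat.cast_sum, nrc]
  exact hunit

end Summit.BirchSwinnertonDyer.BirchSwinnertonDyer.Theorems.SmallImageValve

end
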